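/-
Copyright (c) 2026 The HCML crux team. All rights reserved.
Released under Apache 2.0 license as described in the file LICENSE.
Authors: K2E3-p23 (g5) (explicit-unit `hodgecm-mathlib-K2E3-p23-g5`)
-/
import Mathlib.MeasureTheory.Function.LocallyIntegrable
import Mathlib.MeasureTheory.Integral.Bochner.Set
import Mathlib.Topology.Compactness.SigmaCompact
import HarnessLib

/-!
# (GL-[M6]-sc, ASM-core) The non-elliptic estimates from a RADIUS function: Harish-Chandra's «hcanc + hball + hW ⇒ hlim + hdom + hM» bookkeeping

Cell `hodgecm-mathlib`, Track B, line `K2_E3_EllipticInputs`; payer «GL-[M6]-sc» of leaf (11-3-split-sc) (dealer K2E3-plan (g3) D63, line lead K2E3-p23 (g5);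
MEMO «M6sc-BLUEPRINT v3» §1 (ASM)).  The leaf (11-3-split-sc-NE) `sig_K2E3GL3ModUniformizerNonEllEstimates` asks, for the truncated orbital integrals
`Θₙ(g) = ∫_{Ω n} θ(xgx⁻¹) dμ` of a coefficient `θ` along a compact exhaustion `Ω`, for a LIMIT `Fl` and a MAJORANT `M ∈ L¹_loc` almost everywhere on the
exceptional-free set `{¬ E}` (at the socket: non-compact centraliser).  Harish-Chandra's proof (1970, Part VII §3 pp. 71–73) produces them from a RADIUS `R(g)`
(«`Ω(γ) = {1 + σ(x) ≤ c₁(1 + |λ(γ)|)²}`», Theorem 20) beyond which the truncation does not see the orbit, a BALL BOUND by a weight `W` (Theorems 14, 18: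
`≤ c₄|D|^{-1/2}(1+|λ|)^{4ℓ}`) and the local integrability of `W` (Theorem 15).  This GENERIC file is that bookkeeping, once and for all, over any measure space
with an exhaustion indexed by `ℕ`:

* **`nonEllEstimates_of_radius`** — from (hcanc) `∀ n, ∀ᵐ g, ¬E g → ∫_{Ω n} θ(xgx⁻¹) = ∫_{Ω n ∩ Ω (R g)} θ(xgx⁻¹)`, (hball) `∀ᵐ g, ¬E g → ∫_{Ω (R g)} ‖θ(xgx⁻¹)‖ ≤ W g`,
  (hW) `W ∈ L¹_loc`: the three conjuncts of the leaf with `Fl g := ∫_{Ω (R g)} θ(xgx⁻¹)` and `M := W` — the truncated integrals are CONSTANT for `n ≥ R g`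
  (monotone exhaustion), hence converge, and are bounded by `W g` for every `n`.

So the leaf at `G' = GL₃(F) ⧸ ϖ^ℤ·1` is EXACTLY: a radius `R` with (hcanc) [brick T20 + T18] and a weight `W` with (hball) [T14 + T18] and (hW) [T15] — the
bytes those bricks must deliver are the hypotheses below with `Ω :=` the Ad-height exhaustion (B4-0), `E g := IsCompact Z(g)`, `θ y := B v₁ (r y v₁)`.

HONEST LABEL: HC_CM is proved only modulo the 7 printed citations (2 remaining named inputs: hLiu418 = stmt-HodgeConjecture-24832, h413 =
stmt-HodgeConjecture-24833) until rung 0 closes; generic bookkeeping, count-neutral (kernel lane `--supports stmt-HodgeConjecture-24833 --as helper`), THEOREMS ONLY;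
the estimates themselves (T14, T15, T18, T20 at GL₃) are OPEN.

References: Harish-Chandra (van Dijk) 1970, Part VII §3 pp. 71–73 (the radius `Ω(γ)`, eq. (1)–(2), Lebesgue) [cite: HarishChandra1970, Part VII §3 p. 72];
Folland 1995 §2.4 [cite: Folland1995, §2.4].
-/

open MeasureTheory Set Filter Topology

set_option linter.dupNamespace false

namespace Summit.HodgeConjecture.HodgeConjecture.Cruxes.H413.K2E3NonEllEstimatesOfRadius

variable {G : Type*} [TopologicalSpace G] [MeasurableSpace G] (μ : Measure G)

/-- **Localisation at radius `R g` ⇒ the truncated integrals are eventually constant.**  For a monotone family `Ω` (a `CompactExhaustion`) and ONE `g`: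
if `∫_{Ω n} ψ = ∫_{Ω n ∩ Ω (R g)} ψ` for all `n`, then `∫_{Ω n} ψ = ∫_{Ω (R g)} ψ` for `n ≥ R g`, and `∫_{Ω n} ψ → ∫_{Ω (R g)} ψ`.
[cite: HarishChandra1970, Part VII §3 p. 72] -/
theorem tendsto_setIntegral_of_forall_eq_inter (Ω : CompactExhaustion G) (ψ : G → ℂ) (R : ℕ)
    (hloc : ∀ n : ℕ, ∫ x in Ω n, ψ x ∂μ = ∫ x in Ω n ∩ Ω R, ψ x ∂μ) :
    (∀ n, R ≤ n → ∫ x in Ω n, ψ x ∂μ = ∫ x in Ω R, ψ x ∂μ) ∧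
      Tendsto (fun n : ℕ => ∫ x in Ω n, ψ x ∂μ) atTop (𝓝 (∫ x in Ω R, ψ x ∂μ)) := by
  have hconst : ∀ n, R ≤ n → ∫ x in Ω n, ψ x ∂μ = ∫ x in Ω R, ψ x ∂μ := fun n hn => by
    rw [hloc n, Set.inter_eq_right.2 (Ω.subset hn)]
  exact ⟨hconst, tendsto_atTop_of_eventually_const (i₀ := R) fun n hn => hconst n hn⟩

/-- **A localised truncated integral is bounded by the ball integral of the norm**: `‖∫_{Ω n} ψ‖ ≤ ∫_{Ω R} ‖ψ‖` if `∫_{Ω n} ψ = ∫_{Ω n ∩ Ω R} ψ` and `ψ` is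
integrable on the compact `Ω R` (here: continuous). [cite: HarishChandra1970, Part VII §3 p. 72] -/
theorem norm_setIntegral_le_of_eq_inter (Ω : CompactExhaustion G) {ψ : G → ℂ} (R n : ℕ) (hint : IntegrableOn (fun x => ‖ψ x‖) (Ω R) μ)
    (hloc : ∫ x in Ω n, ψ x ∂μ = ∫ x in Ω n ∩ Ω R, ψ x ∂μ) :
    ‖∫ x in Ω n, ψ x ∂μ‖ ≤ ∫ x in Ω R, ‖ψ x‖ ∂μ := by
  rw [hloc]
  calc ‖∫ x in Ω n ∩ Ω R, ψ x ∂μ‖ ≤ ∫ x in Ω n ∩ Ω R, ‖ψ x‖ ∂μ := norm_integral_le_integral_norm _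
    _ ≤ ∫ x in Ω R, ‖ψ x‖ ∂μ := setIntegral_mono_set hint (Eventually.of_forall fun _ => norm_nonneg _) (Eventually.of_forall Set.inter_subset_right)

/-- **(ASM-core) THE NON-ELLIPTIC ESTIMATES FROM A RADIUS AND A WEIGHT** (Harish-Chandra's bookkeeping, pp. 71–73): on a topological group `G` with a measure
`μ`, for `θ : G → ℂ` continuous, a compact exhaustion `Ω`, an exceptional predicate `E`, a radius `R : G → ℕ` and a weight `W : G → ℝ`: IF (hcanc) for every
`n`, for a.e. `g` with `¬E g`, `∫_{Ω n} θ(xgx⁻¹) = ∫_{Ω n ∩ Ω (R g)} θ(xgx⁻¹)`, (hball) for a.e. `g` with `¬E g`, `∫_{Ω (R g)} ‖θ(xgx⁻¹)‖ ≤ W g`, and (hW)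
`W ∈ L¹_loc(μ)`, THEN with `Fl g := ∫_{Ω (R g)} θ(xgx⁻¹)` and `M := W`: (lim∖E) `Θₙ(g) → Fl g`, (dom∖E) `‖Θₙ(g)‖ ≤ M g` for all `n`, a.e. on `{¬E}`, and
`M ∈ L¹_loc` — the three conjuncts of the leaf (11-3-split-sc-NE) ∕ the inputs `hlim hdom hM` of ★ B6-core. [cite: HarishChandra1970, Part VII §3 p. 72]
[cite: Folland1995, §2.4] -/
theorem nonEllEstimates_of_radius [Group G] [IsTopologicalGroup G] [T2Space G] [OpensMeasurableSpace G] [IsFiniteMeasureOnCompacts μ]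
    {θ : G → ℂ} (hθ : Continuous θ) (Ω : CompactExhaustion G) (E : G → Prop) (R : G → ℕ) (W : G → ℝ)
    (hcanc : ∀ n : ℕ, ∀ᵐ g ∂μ, ¬ E g → ∫ x in Ω n, θ (x * g * x⁻¹) ∂μ = ∫ x in Ω n ∩ Ω (R g), θ (x * g * x⁻¹) ∂μ)
    (hball : ∀ᵐ g ∂μ, ¬ E g → ∫ x in Ω (R g), ‖θ (x * g * x⁻¹)‖ ∂μ ≤ W g)
    (hW : LocallyIntegrable W μ) :
    ∃ (Fl : G → ℂ) (M : G → ℝ),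
      (∀ᵐ g ∂μ, ¬ E g → Tendsto (fun n : ℕ => ∫ x in Ω n, θ (x * g * x⁻¹) ∂μ) atTop (𝓝 (Fl g))) ∧
      (∀ n : ℕ, ∀ᵐ g ∂μ, ¬ E g → ‖∫ x in Ω n, θ (x * g * x⁻¹) ∂μ‖ ≤ M g) ∧
      LocallyIntegrable M μ := by
  refine ⟨fun g => ∫ x in Ω (R g), θ (x * g * x⁻¹) ∂μ, W, ?_, fun n => ?_, hW⟩
  · have hall : ∀ᵐ g ∂μ, ∀ n : ℕ, ¬ E g → ∫ x in Ω n, θ (x * g * x⁻¹) ∂μ = ∫ x in Ω n ∩ Ω (R g), θ (x * g * x⁻¹) ∂μ := ae_all_iff.2 hcanc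
    filter_upwards [hall] with g hg hE
    exact (tendsto_setIntegral_of_forall_eq_inter μ Ω (fun x => θ (x * g * x⁻¹)) (R g) fun n => hg n hE).2
  · filter_upwards [hcanc n, hball] with g hg hb hE
    have hint : IntegrableOn (fun x : G => ‖θ (x * g * x⁻¹)‖) (Ω (R g)) μ :=
      ((hθ.comp ((continuous_id.mul continuous_const).mul continuous_id.inv)).norm.continuousOn).integrableOn_compact (Ω.isCompact (R g))
    exact (norm_setIntegral_le_of_eq_inter μ Ω (R g) n hint (hg hE)).trans (hb hE)

end Summit.HodgeConjecture.HodgeConjecture.Cruxes.H413.K2E3NonEllEstimatesOfRadius
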